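import Literature.NumberTheory.EllipticCurves.TwoIsogenyDualPoints
import Literature.NumberTheory.EllipticCurves.TianYuanZhang2017.GenusDescentAbstract
import Literature.NumberTheory.EllipticCurves.TianYuanZhang2017.ScriptLOddOfRhoZero
import Literature.NumberTheory.EllipticCurves.TwoIsogenyDescentIndex
import Literature.NumberTheory.EllipticCurves.TwoIsogenySelmerGroupRankProofs
import Literature.NumberTheory.EllipticCurves.FaulknerJames2007.RhoIndexEvenPartitionBound
import Literature.NumberTheory.EllipticCurves.CongruentNumberCurveTorsionProofs
import Literature.NumberTheory.EllipticCurves.IsogenyMordellWeilRankProofs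
import Literature.NumberTheory.EllipticCurves.LeadingTerm
import Mathlib.GroupTheory.Perm.Cycle.Type
import HarnessLib

/-!
# Tian–Yuan–Zhang, W2 kernel: the `E_n(ℚ)`-side lemmas ("EnSide")

W2 of the `bsd-rank1-residual` P2 programme (p2-lead ML-56; p2-monsky-lit GEN 8), file 3/6.  The objects are
the tree's: `E_n = congruentNumberCurve n` (`y² = x³ − n²x`), `A_n′ = (congruentNumberCurve n).twoIsogenyCodomain`
(`Y² = X³ + 4n²X`, TYZ's `A_n` up to the scaling of §1), the NAMED dual `ψ_ℚ = twoIsogenyDualHomOf`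
(`TwoIsogenyDualPoints`, = TYZ's `φ_n : A_n → E_n`), and `rhoSubgroup n` (`2^{ρ(n)} = [E_n(ℚ) : φ_n(A_n(ℚ)) + E_n[2]]`,
[TYZ, §1, p0002 L101–L110]).  Proved here (no `def … : Prop`, no sorry):
* `rhoSubgroup_eq_sup : rhoSubgroup n = range ψ_ℚ ⊔ E_n[2]` (the printed subgroup IS `φ_n(A_n(ℚ)) + E_n[2]`);
* `stub_S3`: `∃ ρ, (rhoSubgroup n).index = 2^ρ`;  `S4`: `IsScriptL n L ∧ L ≠ 0 ⇒ analyticRank E_n ≤ 1`;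
* `stub_S0/S0'`: `rank E_n(ℚ) ≤ 1 ⇒ E_n(ℚ)` and `A_n′(ℚ)` are cyclic modulo torsion;
* `stub_S1` (**the index lemma**, "no ρ left"): if `(rhoSubgroup n).index = 2^ρ` and `R`, `α₀` generate `E_n(ℚ)`,
  `A_n′(ℚ)` modulo torsion, then `ψ_ℚ α₀ = ε2^ρ R + t₂` with `ε = ±1`, `2t₂ = 0`.
(The historical names `stub_…` are kept: these were the stubs of the PHASE-0 skeleton, all discharged.)
HONEST FRAMING: pure algebra on tree objects; consumed by `UPlusOfGenusPointData` (file 6/6) where U⁺ becomes a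
theorem MODULO the displayed printed statements `tyz_genusPointData` + GZK by name; nothing about BSD is asserted here.

## References
* Y. Tian, X. Yuan, S.-W. Zhang, Asian J. Math. 21 (2017), arXiv:1411.4728, §1 (p0002 L101–L110), §3.1. [TianYuanZhang2017]
* J. H. Silverman, J. T. Tate, *Rational Points on Elliptic Curves*, §3.4–3.5. [SilvermanTate2015]
-/

noncomputable section

open scoped Classical

namespace Literature.NumberTheory.EllipticCurves.TianYuanZhang2017.W2

open _root_.WeierstrassCurve _root_.WeierstrassCurve.Affine
open Literature.NumberTheory.EllipticCurves
open Literature.NumberTheory.EllipticCurves.TianYuanZhang2017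

/-- `E_n : y² = x³ − n²x` is in two-torsion normal form (`a₁ = a₃ = a₆ = 0`). [cite: TianYuanZhang2017, §1 (chunk p0002 L101–L110) and §3.1 (p0011 L27–L36)] -/
instance isTwoTorsionNF_congruentNumberCurve (n : ℕ) : (congruentNumberCurve n).IsTwoTorsionNF :=
  ⟨rfl, rfl, rfl⟩

/-! ### `Atwo`, `ψQ` and the kernel/range facts of the named dual -/

section EnSide

variable (n : ℕ) [(congruentNumberCurve n).IsElliptic]

/-- `E₂ = Y² = X³ + 4n²X = A_n′`, the codomain of the tree's explicit `2`-isogeny of `E_n` (`= curveA^{(−n)}`). [cite: TianYuanZhang2017, §1 (chunk p0002 L101–L110) and §3.1 (p0011 L27–L36)] -/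
abbrev Atwo : WeierstrassCurve ℚ := (congruentNumberCurve n).twoIsogenyCodomain

/-- `φ_n : A_n′(ℚ) → E_n(ℚ)` = the NAMED dual on `ℚ`-points (K3′; `Rat`'s `DecidableEq`). [cite: TianYuanZhang2017, §1 (chunk p0002 L101–L110) and §3.1 (p0011 L27–L36)] -/
abbrev ψQ : (Atwo n).toAffine.Point →+ (congruentNumberCurve n).toAffine.Point :=
  (congruentNumberCurve n).twoIsogenyDualHomOf

variable {n}

/-- `ker ψ_ℚ = {0, T̄}` (K3′). [cite: TianYuanZhang2017, §1 (chunk p0002 L101–L110) and §3.1 (p0011 L27–L36)] -/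
theorem ψQ_eq_zero_iff (Q : (Atwo n).toAffine.Point) :
    ψQ n Q = 0 ↔ Q = 0 ∨ Q = (Atwo n).twoTorsionPoint :=
  (congruentNumberCurve n).twoIsogenyDualFun_eq_zero_iff Q

/-- `range ψ_ℚ = ker α` (K3′). [cite: TianYuanZhang2017, §1 (chunk p0002 L101–L110) and §3.1 (p0011 L27–L36)] -/
theorem xSqClass_eq_one_iff_exists_ψQ (P : (congruentNumberCurve n).toAffine.Point) :
    (congruentNumberCurve n).xSqClass P = 1 ↔ ∃ Q, ψQ n Q = P :=
  (congruentNumberCurve n).xSqClass_eq_one_iff_exists_twoIsogenyDualFun P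

end EnSide

/-! ### The `E_n(ℚ)`-side lemmas (historical names `stub_…` from the PHASE-0 skeleton; all proved) -/

section Stubs

variable {n : ℕ}

/-- **The dual `ψ` with the Silverman–Tate specification, RE-STATED at an explicit `DecidableEq`**
(junction lemma for the `DecidableEq` diamond; `φ` enters only through the plain function
`twoIsogenyFun`). From the tree's `exists_twoIsogenyDualHom`. [cite: TianYuanZhang2017, §1 (chunk p0002 L101–L110) and §3.1 (p0011 L27–L36)] -/
theorem exists_twoIsogenyDualHom' {F : Type*} [Field F] [dF : DecidableEq F] (W : WeierstrassCurve F)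
    [W.IsTwoTorsionNF] [W.IsElliptic] :
    ∃ ψ : W.twoIsogenyCodomain.toAffine.Point →+ W.toAffine.Point,
      (∀ P, ψ (W.twoIsogenyFun P) = 2 • P) ∧
      (∀ Q, ψ Q = 0 ↔ Q = 0 ∨ Q = W.twoIsogenyCodomain.twoTorsionPoint) ∧
      (∀ P, W.xSqClass P = 1 ↔ ∃ Q, ψ Q = P) := by
  have e : dF = Classical.decEq F := Subsingleton.elim _ _
  subst e
  exact W.exists_twoIsogenyDualHom

/-- **Weak Mordell–Weil, RE-STATED at an explicit `DecidableEq`** (junction lemma): `E(K)/2E(K)` is finite. [cite: TianYuanZhang2017, §1 (chunk p0002 L101–L110) and §3.1 (p0011 L27–L36)] -/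
theorem finite_quotient_two_nsmul_range' {K : Type*} [Field K] [NumberField K] [dK : DecidableEq K]
    (W : WeierstrassCurve K) [W.IsElliptic] :
    Finite (W.toAffine.Point ⧸ (nsmulAddMonoidHom 2 : W.toAffine.Point →+ W.toAffine.Point).range) := by
  have e : dK = Classical.decEq K := Subsingleton.elim _ _
  subst e
  exact W.finite_quotient_two_nsmul_range

/-- **`φ_n(A_n(ℚ)) = {P ∈ E_n(ℚ) : α(P) = 1}`** (`α = x mod ℚ^{×2}`): the printed image set
`isogenyImageTYZ n` is the kernel of the descent map — `⊆` by `x = n(u + u⁻¹)/2 = (nv/u)²` on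
`2nv² = u³ + u`, `⊇` by GEN 2's explicit preimage `some_mem_isogenyImageTYZ_of_sq` (and `α(T) = [−n²] ≠ 1`). [cite: TianYuanZhang2017, §1 (chunk p0002 L101–L110) and §3.1 (p0011 L27–L36)] -/
theorem mem_isogenyImageTYZ_iff (hn : n ≠ 0) (P : (congruentNumberCurve n).toAffine.Point) :
    P ∈ isogenyImageTYZ n ↔ (congruentNumberCurve n).xSqClass P = 1 := by
  have hn0 : (n : ℚ) ≠ 0 := Nat.cast_ne_zero.mpr hn
  constructor
  · rintro (rfl | ⟨u, v, huv, hu, h, rfl⟩)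
    · rfl
    · have hv : v ≠ 0 := by
        rintro rfl
        have h0 : u * (u ^ 2 + 1) = 0 := by linear_combination huv.symm
        rcases mul_eq_zero.mp h0 with h0 | h0
        · exact hu h0
        · nlinarith [sq_nonneg u]
      have hx : (n : ℚ) * ((u + u⁻¹) / 2) = ((n : ℚ) * v / u) ^ 2 := by
        field_simp
        linear_combination -huv
      have hx0 : (n : ℚ) * ((u + u⁻¹) / 2) ≠ 0 := by
        rw [hx]; exact pow_ne_zero _ (div_ne_zero (mul_ne_zero hn0 hv) hu)
      rw [xSqClass_some_of_ne_zero _ hx0, hx, sqClass_sq]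
  · intro h1
    rcases P with _ | ⟨x, y, hP⟩
    · exact Or.inl rfl
    · by_cases hx : x = 0
      · exfalso
        rw [xSqClass_some_of_eq_zero _ hx, congruentNumberCurve_a₄,
          sqClass_eq_one_iff (neg_ne_zero.mpr (pow_ne_zero 2 hn0))] at h1
        obtain ⟨w, hw⟩ := h1
        nlinarith [sq_nonneg w, sq_nonneg (n : ℚ), pow_pos (show (0:ℚ) < n by positivity) 2]
      · rw [xSqClass_some_of_ne_zero _ hx, sqClass_eq_one_iff hx] at h1
        obtain ⟨w, hw⟩ := h1
        have hw0 : w ≠ 0 := by rintro rfl; exact hx (by rw [hw]; ring)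
        exact FaulknerJames2007.some_mem_isogenyImageTYZ_of_sq hn hP hw0 hw

/-- `rhoSubgroup n = ⟨range ψ⟩ ⊔ ⟨E_n[2]⟩` for any `ψ` with `range ψ = ker α`. [cite: TianYuanZhang2017, §1 (chunk p0002 L101–L110) and §3.1 (p0011 L27–L36)] -/
theorem rhoSubgroup_eq_sup (hn : n ≠ 0) [(congruentNumberCurve n).IsElliptic]
    (ψQ : (Atwo n).toAffine.Point →+ (congruentNumberCurve n).toAffine.Point)
    (hψQ_range : ∀ P, (congruentNumberCurve n).xSqClass P = 1 ↔ ∃ Q, ψQ Q = P) :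
    rhoSubgroup n = ψQ.range ⊔ AddSubgroup.torsionBy (congruentNumberCurve n).toAffine.Point (2 : ℕ) := by
  have h1 : isogenyImageTYZ n = (ψQ.range : Set (congruentNumberCurve n).toAffine.Point) := by
    ext P
    rw [mem_isogenyImageTYZ_iff hn, hψQ_range, AddMonoidHom.coe_range, Set.mem_range]
  have h2 : {P : (congruentNumberCurve n).toAffine.Point | (2 : ℕ) • P = 0} =
      (AddSubgroup.torsionBy (congruentNumberCurve n).toAffine.Point (2 : ℕ) : Set _) := by
    ext P
    simp only [Set.mem_setOf_eq, SetLike.mem_coe, AddSubgroup.torsionBy.nsmul_iff]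
  unfold rhoSubgroup
  rw [h1, h2, AddSubgroup.closure_union, AddSubgroup.closure_eq, AddSubgroup.closure_eq]

/-- **stub_S3** (CLOSED; `ρ(n)` exists): the index of `φ_n(A_n(ℚ)) + E_n[2]` in `E_n(ℚ)` is a power of
`2` — it contains `2E_n(ℚ) = ψ(φ(E_n(ℚ)))`, and `E_n(ℚ)/2E_n(ℚ)` is a finite group of exponent `2`
(weak Mordell–Weil + Cauchy). [cite: TianYuanZhang2017, §1 (chunk p0002 L101–L110) and §3.1 (p0011 L27–L36)] -/
theorem stub_S3 (hsq : Squarefree n) : ∃ ρ : ℕ, (rhoSubgroup n).index = 2 ^ ρ := by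
  haveI := isElliptic_congruentNumberCurve hsq.ne_zero
  obtain ⟨ψ, hcomp, -, hrange⟩ := exists_twoIsogenyDualHom' (congruentNumberCurve n)
  set G := (congruentNumberCurve n).toAffine.Point
  set twoG : AddSubgroup G := (nsmulAddMonoidHom 2 : G →+ G).range with htwoG
  -- `2E_n(ℚ) ≤ rhoSubgroup n`
  have hle : twoG ≤ rhoSubgroup n := by
    rintro _ ⟨P, rfl⟩
    rw [rhoSubgroup_eq_sup hsq.ne_zero ψ hrange]
    refine AddSubgroup.mem_sup_left ⟨(congruentNumberCurve n).twoIsogenyFun P, ?_⟩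
    rw [hcomp]; rfl
  -- `[E_n(ℚ) : 2E_n(ℚ)]` is a power of two
  haveI hfin : Finite (G ⧸ twoG) := finite_quotient_two_nsmul_range' (congruentNumberCurve n)
  have hidx : twoG.index ≠ 0 := AddSubgroup.index_ne_zero_of_finite
  have hpow : twoG.index = 2 ^ twoG.index.primeFactorsList.length := by
    refine Nat.eq_prime_pow_of_unique_prime_dvd hidx fun {d} hd hdvd => ?_
    haveI : Fact d.Prime := ⟨hd⟩
    rw [AddSubgroup.index_eq_card] at hdvd
    obtain ⟨x, hx⟩ := exists_prime_addOrderOf_dvd_card' (G := G ⧸ twoG) d hdvd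
    -- every element of `E/2E` is killed by `2`
    have h2x : (2 : ℕ) • x = 0 := by
      induction x using QuotientAddGroup.induction_on with
      | H z =>
        rw [← QuotientAddGroup.mk_nsmul, QuotientAddGroup.eq_zero_iff]
        exact ⟨z, rfl⟩
    have hd2 : d ∣ 2 := by rw [← hx]; exact addOrderOf_dvd_of_nsmul_eq_zero h2x
    exact (Nat.prime_dvd_prime_iff_eq hd Nat.prime_two).mp hd2
  obtain ⟨ρ, -, hρ⟩ := (Nat.dvd_prime_pow Nat.prime_two).mp (hpow ▸ AddSubgroup.index_dvd_of_le hle)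
  exact ⟨ρ, hρ⟩

/-- **S4 (CLOSED by the tree)**: a non-zero integral `𝓛(n)` forces `ord_{s=1} L(E_n, s) = 1` for
square-free `n ≡ 5, 6, 7 (mod 8)` — lit-1's `analyticRank_congruentNumberCurve_eq_one_of_isScriptL`. [cite: TianYuanZhang2017, §1 (chunk p0002 L101–L110) and §3.1 (p0011 L27–L36)] -/
theorem S4 (hsq : Squarefree n) (h8 : n % 8 = 5 ∨ n % 8 = 6 ∨ n % 8 = 7) {L : ℤ} (hL : IsScriptL n L)
    (hL0 : L ≠ 0) : (congruentNumberCurve n).analyticRank ≤ 1 :=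
  (analyticRank_congruentNumberCurve_eq_one_of_isScriptL hsq h8 hL hL0).le

/-- **S0, general form**: over a number field, rank `≤ 1` ⇒ `E(K)` is cyclic modulo
torsion (the tree's Mordell–Weil basis `exists_isMordellWeilBasis_holds`).  DESIGN NOTE (the
`DecidableEq` diamond): Mathlib's group law on `W.toAffine.Point` takes `[DecidableEq F]`; the tree's
general-field lemmas bake in `Classical.decEq`, while statements written at `ℚ` pick `Rat`'s instance.
Junction lemmas are therefore RE-STATED with an explicit binder `[dK : DecidableEq K]` and proved by
`subst (Subsingleton.elim dK (Classical.decEq K))` + the classical tree lemma. [cite: TianYuanZhang2017, §1 (chunk p0002 L101–L110) and §3.1 (p0011 L27–L36)] -/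
theorem exists_generator_mod_torsion {K : Type*} [Field K] [NumberField K] [dK : DecidableEq K]
    (W : WeierstrassCurve K) [W.IsElliptic] (hr : W.mordellWeilRank ≤ 1) :
    ∃ R : W.toAffine.Point, ∀ x : W.toAffine.Point, ∃ k : ℤ, IsOfFinAddOrder (x - k • R) := by
  have e : dK = Classical.decEq K := Subsingleton.elim _ _
  subst e
  obtain ⟨P, _, hspan⟩ := W.exists_isMordellWeilBasis_holds
  -- the (at most one) basis vector
  set R : W.toAffine.Point := if h : 0 < W.mordellWeilRank then P ⟨0, h⟩ else 0 with hRdef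
  refine ⟨R, fun x => ?_⟩
  have hrange : Set.range (QuotientAddGroup.mk ∘ P : Fin W.mordellWeilRank → mordellWeilModTorsion W) ⊆
      {(QuotientAddGroup.mk R : mordellWeilModTorsion W)} := by
    rintro _ ⟨i, rfl⟩
    have hi : 0 < W.mordellWeilRank := lt_of_le_of_lt (Nat.zero_le _) i.isLt
    have hi0 : i = ⟨0, hi⟩ := Fin.ext (by have := i.isLt; omega)
    simp only [Set.mem_singleton_iff, Function.comp_apply, hRdef, dif_pos hi, hi0]
  have hx : (QuotientAddGroup.mk x : mordellWeilModTorsion W) ∈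
      Submodule.span ℤ {(QuotientAddGroup.mk R : mordellWeilModTorsion W)} := by
    have htop : (QuotientAddGroup.mk x : mordellWeilModTorsion W) ∈ (⊤ : Submodule ℤ _) := trivial
    rw [← hspan] at htop
    exact Submodule.span_mono hrange htop
  rw [Submodule.mem_span_singleton] at hx
  obtain ⟨k, hk⟩ := hx
  refine ⟨k, ?_⟩
  rw [← AddCommGroup.mem_torsion, ← QuotientAddGroup.eq_zero_iff, QuotientAddGroup.mk_sub,
    QuotientAddGroup.mk_zsmul, hk, sub_self]

/-- **stub_S0** (CLOSED): rank `≤ 1` ⇒ `E_n(ℚ)` is cyclic modulo torsion. [cite: TianYuanZhang2017, §1 (chunk p0002 L101–L110) and §3.1 (p0011 L27–L36)] -/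
theorem stub_S0 [(congruentNumberCurve n).IsElliptic] (hr : (congruentNumberCurve n).mordellWeilRank ≤ 1) :
    ∃ R : (congruentNumberCurve n).toAffine.Point,
      ∀ x : (congruentNumberCurve n).toAffine.Point, ∃ k : ℤ, IsOfFinAddOrder (x - k • R) :=
  exists_generator_mod_torsion _ hr

/-- **stub_S0'** (CLOSED): … and then `E₂(ℚ) = A_n(ℚ)` is cyclic modulo torsion too (isogeny invariance
of the rank, tree `Isogeny.mordellWeilRank_eq` for `twoIsogeny`). [cite: TianYuanZhang2017, §1 (chunk p0002 L101–L110) and §3.1 (p0011 L27–L36)] -/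
theorem stub_S0' [(congruentNumberCurve n).IsElliptic] (hr : (congruentNumberCurve n).mordellWeilRank ≤ 1) :
    ∃ α : (Atwo n).toAffine.Point,
      ∀ x : (Atwo n).toAffine.Point, ∃ k : ℤ, IsOfFinAddOrder (x - k • α) :=
  exists_generator_mod_torsion _ (((congruentNumberCurve n).twoIsogeny.mordellWeilRank_eq).symm ▸ hr)

/-- **stub_S1 — THE `rhoSubgroup` INDEX LEMMA (Step 1; REQUIRED because F1 is displayed verbatim with
`ρ` and `α_n`, L1-56):** for square-free `n`, a dual `ψ` with the Silverman–Tate specification, `R`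
generating `E_n(ℚ)` modulo torsion and `α` generating `E₂(ℚ)` modulo torsion,
`[E_n(ℚ) : ψ(E₂(ℚ)) + E_n[2]] = 2^ρ` forces `ψ(α) = ±2^ρ R + t₂` with `2t₂ = 0`.
Ingredients: `rhoSubgroup n = ψ(E₂(ℚ)) ⊔ E_n[2]` (`isogenyImageTYZ n = {P : x(P) ∈ ℚ^{×2}} ∪ {O}` by
GEN 2's `some_mem_isogenyImageTYZ_of_sq` and the converse computation `x = (nv/u)²`, `= range ψ` by
`hψ_range`), `E_n(ℚ)_tors = E_n[2]` (`torsion_congruentNumberCurve_eq_torsionBy_two`), and the index of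
`ℤkR̄` in `E_n(ℚ)/E_n[2] ≅ ℤ`. [cite: TianYuanZhang2017, §1 (chunk p0002 L101–L110) and §3.1 (p0011 L27–L36)] -/
theorem stub_S1 (hsq : Squarefree n) [(congruentNumberCurve n).IsElliptic]
    (ψQ : (Atwo n).toAffine.Point →+ (congruentNumberCurve n).toAffine.Point)
    (hψQ_range : ∀ P, (congruentNumberCurve n).xSqClass P = 1 ↔ ∃ Q, ψQ Q = P)
    {ρ : ℕ} (hρ : (rhoSubgroup n).index = 2 ^ ρ)
    {R : (congruentNumberCurve n).toAffine.Point} (hR : ∀ x, ∃ k : ℤ, IsOfFinAddOrder (x - k • R))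
    {α : (Atwo n).toAffine.Point} (hα : ∀ x, ∃ k : ℤ, IsOfFinAddOrder (x - k • α)) :
    ∃ ε : ℤ, (ε = 1 ∨ ε = -1) ∧ ∃ t₂ : (congruentNumberCurve n).toAffine.Point,
      (2 : ℕ) • t₂ = 0 ∧ ψQ α = (ε * 2 ^ ρ) • R + t₂ := by
  have h2tor : ∀ {t : (congruentNumberCurve n).toAffine.Point}, IsOfFinAddOrder t → (2 : ℕ) • t = 0 :=
    fun ht => two_nsmul_eq_zero_of_isOfFinAddOrder_congruentNumberCurve hsq ht
  -- `ψ α = k R + t`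
  obtain ⟨k, hk⟩ := hR (ψQ α)
  set t : (congruentNumberCurve n).toAffine.Point := ψQ α - k • R with ht
  have hψα : ψQ α = k • R + t := by rw [ht]; abel
  set Hk : AddSubgroup (congruentNumberCurve n).toAffine.Point :=
    ψQ.range ⊔ AddSubgroup.torsionBy (congruentNumberCurve n).toAffine.Point (2 : ℕ) with hHk
  have hsub : rhoSubgroup n = Hk := rhoSubgroup_eq_sup hsq.ne_zero ψQ hψQ_range
  have hmemT : ∀ {s : (congruentNumberCurve n).toAffine.Point}, IsOfFinAddOrder s →
      s ∈ AddSubgroup.torsionBy (congruentNumberCurve n).toAffine.Point (2 : ℕ) := fun hs =>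
    AddSubgroup.torsionBy.nsmul_iff.mpr (h2tor hs)
  rw [hsub] at hρ
  by_cases hRtor : IsOfFinAddOrder R
  · -- CASE A: `E_n(ℚ)` is torsion; then `rhoSubgroup = ⊤`, `ρ = 0`
    have hall : ∀ x : (congruentNumberCurve n).toAffine.Point, IsOfFinAddOrder x := by
      intro x
      obtain ⟨j, hj⟩ := hR x
      have := hj.add (hRtor.zsmul (i := j))
      rwa [sub_add_cancel] at this
    have htop : Hk = ⊤ := by
      rw [eq_top_iff]
      intro x _
      exact AddSubgroup.mem_sup_right (hmemT (hall x))
    have hρ0 : ρ = 0 := by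
      rw [htop, AddSubgroup.index_top] at hρ
      have h' : 2 ^ ρ = 2 ^ 0 := by rw [pow_zero]; exact hρ.symm
      exact Nat.pow_right_injective (le_refl 2) h'
    subst hρ0
    refine ⟨1, Or.inl rfl, ψQ α - R, h2tor (hall _), ?_⟩
    simp only [pow_zero, mul_one, one_smul]
    abel
  · -- CASE B: `R` of infinite order: `E_n(ℚ)/Hk ≅ ℤ/kℤ` via `j ↦ [jR]`
    set Φ : ℤ →+ (congruentNumberCurve n).toAffine.Point ⧸ Hk :=
      (QuotientAddGroup.mk' Hk).comp (zmultiplesHom _ R) with hΦ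
    have hΦapply : ∀ j : ℤ, Φ j = QuotientAddGroup.mk (j • R) := fun j => rfl
    have hsurj : Function.Surjective Φ := by
      intro q
      induction q using QuotientAddGroup.induction_on with
      | H x =>
        obtain ⟨j, hj⟩ := hR x
        refine ⟨j, ?_⟩
        rw [hΦapply, QuotientAddGroup.eq, neg_add_eq_sub]
        exact AddSubgroup.mem_sup_right (hmemT hj)
    have hkmem : k • R ∈ Hk := by
      have e : k • R = ψQ α + -t := by rw [hψα]; abel
      rw [e]
      exact AddSubgroup.add_mem _ (AddSubgroup.mem_sup_left ⟨α, rfl⟩)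
        (AddSubgroup.mem_sup_right (hmemT hk.neg))
    -- `m • R` of finite order forces `m = 0`
    have hfree : ∀ {m : ℤ}, IsOfFinAddOrder (m • R) → m = 0 := by
      intro m hm
      by_contra hne
      apply hRtor
      have habs : IsOfFinAddOrder (m.natAbs • R) := by
        rw [← natCast_zsmul]
        rcases Int.natAbs_eq m with e | e
        · rwa [← e]
        · have e' : (m.natAbs : ℤ) = -m := by omega
          rw [e', neg_smul]; exact hm.neg
      exact W2.Abstract.isOfFinAddOrder_of_nsmul (Int.natAbs_ne_zero.mpr hne) habs
    have hker : Φ.ker = AddSubgroup.zmultiples k := by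
      ext j
      rw [AddMonoidHom.mem_ker, hΦapply, QuotientAddGroup.eq_zero_iff, AddSubgroup.mem_zmultiples_iff]
      constructor
      · intro hj
        obtain ⟨y, hy, s, hs, hsum⟩ := AddSubgroup.mem_sup.mp hj
        obtain ⟨x, rfl⟩ := hy
        obtain ⟨i, hi⟩ := hα x
        have hsT : IsOfFinAddOrder s :=
          isOfFinAddOrder_iff_nsmul_eq_zero.mpr ⟨2, two_pos, AddSubgroup.torsionBy.nsmul_iff.mp hs⟩
        have hx' : ψQ x = j • R - s := eq_sub_of_add_eq hsum
        have hfin : IsOfFinAddOrder ((j - i * k) • R) := by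
          have e : (j - i * k) • R = ψQ (x - i • α) + i • t + s := by
            rw [map_sub, map_zsmul, hx', hψα]
            module
          rw [e]
          exact ((ψQ.isOfFinAddOrder hi).add hk.zsmul).add hsT
        have h0 := hfree hfin
        exact ⟨i, by rw [smul_eq_mul]; linarith⟩
      · rintro ⟨c, rfl⟩
        rw [smul_eq_mul, mul_smul]
        exact AddSubgroup.zsmul_mem _ hkmem c
    have hidx : Hk.index = k.natAbs := by
      rw [AddSubgroup.index_eq_card,
        ← Nat.card_congr (QuotientAddGroup.quotientKerEquivOfSurjective Φ hsurj).toEquiv, hker,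
        ← AddSubgroup.index_eq_card, Int.index_zmultiples]
    rw [hidx] at hρ
    rcases Int.natAbs_eq k with hk' | hk'
    · have hk2 : k = 2 ^ ρ := by rw [hk', hρ]; norm_cast
      exact ⟨1, Or.inl rfl, t, h2tor hk, by rw [hψα, hk2, one_mul]⟩
    · have hk2 : k = -2 ^ ρ := by rw [hk', hρ]; norm_cast
      exact ⟨-1, Or.inr rfl, t, h2tor hk, by rw [hψα, hk2, neg_one_mul]⟩


end Stubs

end Literature.NumberTheory.EllipticCurves.TianYuanZhang2017.W2
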